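import Summits.AtomisticToContinuum.Crystallization.Theses.FluxTubeKepler

/-!
# `FluxCellKepler` (stmt-AtomisticToContinuum-15221), line `Sketch` — necessity: the crux implies stubs 1 and 2

The crux `FluxTubeKepler.FluxCellKepler` provides a periodic configuration `P₀`, a radius `R₁` and a
local tail credit `τ` with

* (DOM) `Σ_i site₆(x)_i ≤ Σ_i τ(pattern_i)` on every finite injective configuration `x` of `ℝ³`, and
* (KEPLER) for all `δ, R, η > 0` some `c > 0` with
  `c · #bad(R, η) ≤ Σ_i ((1/24) site₁₂(x)_i − (1/12) τ(pattern_i)) − N · e(P₀)` on every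
  `δ`-separated finite injective `x`.

This file certifies that the first two stubs of the line's skeleton
(`Cruxes/FluxCellKepler/Lines/Sketch.lean`: `stub_periodicMinimiser`, `stub_defectPricedExcess`) are
CONSEQUENCES of the crux, i.e. the transversal cut loses nothing there:

* FLOOR. By the energy identity `E_LJ(x) = Σ_i ((1/24) site₁₂ − (1/12) site₆)` and DOM the cell sum
  is at most `E_LJ(x)`; every finite injective configuration is `δ`-separated for some `δ > 0`, so
  KEPLER (with `c > 0`, `#bad ≥ 0`) gives `N · e(P₀) ≤ E_LJ(x)`.
* MINIMISER. Along ground states (`LennardJonesGroundStatesExist_holds`) the floor reads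
  `e(P₀) ≤ E(N)/N` (`N ≥ 1`), and `E(N)/N → ⨅_Q e(Q)` (`crysEnergyLimit`) gives
  `e(P₀) ≤ ⨅_Q e(Q) ≤ e(Q)` (`eStar_le`): `P₀` is a periodic minimiser and `e(P₀) = ⨅_Q e(Q)`.
* PRICING. Substituting `e(P₀) = ⨅_Q e(Q)` and `cell sum ≤ E_LJ` in KEPLER is the `τ`-free
  defect pricing of `stub_defectPricedExcess`.
-/

namespace Summit.AtomisticToContinuum.Crystallization.Theorems.FluxCellKeplerSketchNec

open scoped BigOperators
open Literature.MathematicalPhysics.StatisticalMechanics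

/-! ## Private bookkeeping lemmas -/

/-- Site energies of the Lennard-Jones combination split linearly:
`site_LJ = (1/12) site₁₂ − (1/6) site₆`. [folklore] -/
private theorem siteEnergy_lennardJones_eq {d N : ℕ} (x : Fin N → EuclideanSpace ℝ (Fin d))
    (i : Fin N) :
    siteEnergy lennardJones x i
      = (1 / 12 : ℝ) * siteEnergy (fun r => (r⁻¹) ^ 12) x i
          - (1 / 6 : ℝ) * siteEnergy (fun r => (r⁻¹) ^ 6) x i := by
  simp only [siteEnergy, lennardJones, Finset.sum_sub_distrib, Finset.mul_sum]

/-- Energy identity `E_LJ(x) = Σ_i ((1/24) site₁₂(x)_i − (1/12) site₆(x)_i)` (double counting,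
`two_mul_interactionEnergy`, and `V_LJ(r) = (1/12) r⁻¹² − (1/6) r⁻⁶`). [folklore] -/
private theorem interactionEnergy_lennardJones_eq_sum {d N : ℕ}
    (x : Fin N → EuclideanSpace ℝ (Fin d)) :
    interactionEnergy lennardJones x
      = ∑ i, ((1 / 24 : ℝ) * siteEnergy (fun r => (r⁻¹) ^ 12) x i
          - (1 / 12 : ℝ) * siteEnergy (fun r => (r⁻¹) ^ 6) x i) := by
  have h2 := two_mul_interactionEnergy lennardJones x
  rw [Finset.sum_congr rfl fun i _ => siteEnergy_lennardJones_eq x i] at h2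
  have hE : interactionEnergy lennardJones x
      = (1 / 2 : ℝ) * ∑ i, ((1 / 12 : ℝ) * siteEnergy (fun r => (r⁻¹) ^ 12) x i
          - (1 / 6 : ℝ) * siteEnergy (fun r => (r⁻¹) ^ 6) x i) := by
    linarith
  rw [hE, Finset.mul_sum]
  exact Finset.sum_congr rfl fun i _ => by ring

/-- Under DOM the cell sum is dominated by the energy:
`Σ site₆ ≤ Σ τ_i → Σ_i ((1/24) site₁₂ − (1/12) τ_i) ≤ E_LJ(x)`. [folklore] -/
private theorem sum_cellScore_le {d N : ℕ} (x : Fin N → EuclideanSpace ℝ (Fin d)) (t : Fin N → ℝ)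
    (hdom : ∑ i, siteEnergy (fun r => (r⁻¹) ^ 6) x i ≤ ∑ i, t i) :
    ∑ i, ((1 / 24 : ℝ) * siteEnergy (fun r => (r⁻¹) ^ 12) x i - (1 / 12 : ℝ) * t i)
      ≤ interactionEnergy lennardJones x := by
  rw [interactionEnergy_lennardJones_eq_sum, Finset.sum_sub_distrib, Finset.sum_sub_distrib,
    ← Finset.mul_sum, ← Finset.mul_sum, ← Finset.mul_sum]
  linarith

/-- Every finite configuration of distinct points is `δ`-separated for some `δ > 0`. [folklore] -/
private theorem exists_separation {d N : ℕ} {x : Fin N → EuclideanSpace ℝ (Fin d)}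
    (hx : Function.Injective x) : ∃ δ : ℝ, 0 < δ ∧ ∀ i j, i ≠ j → δ ≤ dist (x i) (x j) := by
  by_cases hne : Nonempty {p : Fin N × Fin N // p.1 ≠ p.2}
  · obtain ⟨p₀, hp₀⟩ :=
      Finite.exists_min (fun p : {p : Fin N × Fin N // p.1 ≠ p.2} => dist (x p.1.1) (x p.1.2))
    exact ⟨dist (x p₀.1.1) (x p₀.1.2), dist_pos.2 (hx.ne p₀.2), fun i j hij => hp₀ ⟨(i, j), hij⟩⟩
  · exact ⟨1, one_pos, fun i j hij => absurd ⟨⟨(i, j), hij⟩⟩ hne⟩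

/-- A positive price on a non-negative count below a gap forces the floor:
`0 < c → c k ≤ A − B → 0 ≤ k → A ≤ E → B ≤ E`. [folklore] -/
private theorem le_of_priced {c k A B E : ℝ} (hc : 0 < c) (h : c * k ≤ A - B) (hk : 0 ≤ k)
    (hA : A ≤ E) : B ≤ E := by
  nlinarith [mul_nonneg hc.le hk]

/-! ## The registered stub -/

/-- **Necessity of the cut (stub `stub_cruxNecessity` of line `Sketch`).** The crux
`FluxCellKepler` implies (i) a periodic Lennard-Jones minimiser exists (its `P₀` is one, with
`e(P₀) = ⨅_Q e(Q)`: FLOOR `N e(P₀) ≤ E_LJ` from the energy identity, DOM and KEPLER, then ground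
states, `crysEnergyLimit` and `eStar_le`), and (ii) the `τ`-free defect pricing
`c · #bad ≤ E_LJ(x) − N · ⨅_Q e(Q)` on `δ`-separated configurations (KEPLER, DOM, `e(P₀) = ⨅`).
[folklore] -/
theorem stub_cruxNecessity : Summit.AtomisticToContinuum.Crystallization.Theses.FluxTubeKepler.FluxCellKepler → (∃ P : PeriodicConfiguration 3, IsLeast (Set.range fun Q : PeriodicConfiguration 3 => Q.energyPerParticle lennardJones) (P.energyPerParticle lennardJones)) ∧ (∀ δ : ℝ, 0 < δ → ∀ R η : ℝ, 0 < R → 0 < η → ∃ c : ℝ, 0 < c ∧ ∀ (N : ℕ) (x : Fin N → EuclideanSpace ℝ (Fin 3)), Function.Injective x → (∀ i j, i ≠ j → δ ≤ dist (x i) (x j)) → c * (Nat.card {i : Fin N // ¬ ∃ a : ℝ, 47 / 50 ≤ a ∧ a ≤ 1 ∧ ∃ (A : EuclideanSpace ℝ (Fin 3) →ₗᵢ[ℝ] EuclideanSpace ℝ (Fin 3)) (s : ℤ → ℤ) (z : ℤ → ℝ), IsHaggSeq s ∧ (∀ m : ℤ, 39 / 50 * a ≤ z (m + 1) - z m ∧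 z (m + 1) - z m ≤ 17 / 20 * a) ∧ let S : Set (EuclideanSpace ℝ (Fin 3)) := {p | ∃ m k l : ℤ, p = A (((k : ℝ) • triangularVec₁ a) + ((l : ℝ) • triangularVec₂ a) + ((haggLabel s m : ℝ) • barlowOffset a) + (z m • layerNormal 1))}; (∀ p ∈ S, ‖p‖ ≤ R → ∃ j : Fin N, dist (x j - x i) p ≤ η) ∧ (∀ j : Fin N, ‖x j - x i‖ ≤ R → ∃ p ∈ S, dist (x j - x i) p ≤ η)} : ℝ) ≤ interactionEnergy lennardJones x - (N : ℝ) * ⨅ Q : PeriodicConfiguration 3, Q.energyPerParticle lennardJones) := by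
  rintro ⟨P₀, R₁, τ, hdom, hkep⟩
  -- FLOOR: `N · e(P₀) ≤ E_LJ(x)` for every finite injective `x`
  have hfloor : ∀ (N : ℕ) (x : Fin N → EuclideanSpace ℝ (Fin 3)), Function.Injective x →
      (N : ℝ) * P₀.energyPerParticle lennardJones ≤ interactionEnergy lennardJones x := by
    intro N x hx
    obtain ⟨δ, hδ, hsep⟩ := exists_separation hx
    obtain ⟨c, hc, hcb⟩ := hkep δ hδ 1 1 one_pos one_pos
    exact le_of_priced hc (hcb N x hx hsep) (Nat.cast_nonneg _) (sum_cellScore_le x _ (hdom N x hx))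
  -- MINIMISER: `e(P₀) ≤ ⨅_Q e(Q)` along ground states, `⨅_Q e(Q) ≤ e(Q)` by `eStar_le`
  have hlim :=
    Summit.AtomisticToContinuum.Crystallization.Theorems.ChargedEnergyGapNegative.crysEnergyLimit
  have hle : P₀.energyPerParticle lennardJones
      ≤ ⨅ Q : PeriodicConfiguration 3, Q.energyPerParticle lennardJones := by
    refine ge_of_tendsto hlim (Filter.eventually_atTop.2 ⟨1, fun N hN => ?_⟩)
    obtain ⟨x, hx⟩ := LennardJonesGroundStatesExist_holds N
    have h1 := hfloor N x hx.1
    have hNr : (0 : ℝ) < N := by exact_mod_cast hN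
    rw [le_div_iff₀ hNr, mul_comm]
    rw [hx.2] at h1
    exact h1
  have hge : ∀ Q : PeriodicConfiguration 3,
      (⨅ Q : PeriodicConfiguration 3, Q.energyPerParticle lennardJones)
        ≤ Q.energyPerParticle lennardJones :=
    Summit.AtomisticToContinuum.Crystallization.Theorems.ChargedEnergyGapNegative.eStar_le
  have hleast : IsLeast (Set.range fun Q : PeriodicConfiguration 3 => Q.energyPerParticle lennardJones)
      (P₀.energyPerParticle lennardJones) := by
    refine ⟨⟨P₀, rfl⟩, ?_⟩
    rintro _ ⟨Q, rfl⟩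
    exact hle.trans (hge Q)
  have heq : (⨅ Q : PeriodicConfiguration 3, Q.energyPerParticle lennardJones)
      = P₀.energyPerParticle lennardJones :=
    le_antisymm (hge P₀) hle
  -- PRICING: KEPLER with `cell sum ≤ E_LJ` (DOM) and `e(P₀) = ⨅`
  refine ⟨⟨P₀, hleast⟩, ?_⟩
  intro δ hδ R η hR hη
  obtain ⟨c, hc, hcb⟩ := hkep δ hδ R η hR hη
  refine ⟨c, hc, fun N x hx hsep => ?_⟩
  rw [heq]
  exact (hcb N x hx hsep).trans (sub_le_sub_right (sum_cellScore_le x _ (hdom N x hx)) _)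

end Summit.AtomisticToContinuum.Crystallization.Theorems.FluxCellKeplerSketchNec
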